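import Summits.CriticalPhenomena.PercolationContinuityZ3.Theorems.PercNearOneGluingNoHeavyLowerTailSahiCombCore
import Summits.CriticalPhenomena.PercolationContinuityZ3.Theorems.PercNearOneGluingNoHeavyLowerTailSahiCombHardCore
import Summits.CriticalPhenomena.PercolationContinuityZ3.Theorems.SahiMasterFamilyWidthCollapse

/-!
# The comb (tensor-Bernstein) hierarchy for Sahi's `E_k`, XVIII: comb positivity at EVERY order for families with a core of at most THREE coordinates
# (standard axioms: width of `2^3` + hierarchy lifting + the kernel `C₃` certificate on three coins)

Support file of the one-cut programme (crux `NoHeavyLowerTail`, stmt-CriticalPhenomena-4575; cell `prim-masterthm`, seat P3, gen 3;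
`run/shared/lean/prim/prim-masterthm/prim-masterthm-p3/HIERARCHY.md` §10).  Ingredients: private-coordinate elimination and the cube transport (`…SahiCombPrivate`,
`…SahiCombCore`), hierarchy lifting at the comb level (`…SahiCombHardCore`: fourwise meet absorption + comb-positive sub-triples ⇒ every order), P4's width lemma
(`SahiWidthCollapse.exists_absorbing_of_width`, `finset_width_le_choose`: the cube `2^κ`, `|κ| ≤ 3`, has no four pairwise incomparable subsets), and the kernel certificate of
(M⁺-3) on three coins (`SahiCombCore.combPos_sahiE_three_fam_of_card_le_three`).
* `cardwiseMeetAbsorbing_three_of_card_le_three` — every family of increasing events of a cube with `≤ 3` coordinates is fourwise meet-absorbing;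
* `combPos_sahiE_ind_fam_of_card_le_three` — **(M⁺-n) for EVERY `n` on cubes with at most three coordinates** (no `native_decide`);
* **`combPos_sahiE_ind_of_core_le_three`** — **every family of increasing events of any finite cube whose pairwise-shared coordinates lie in a set of size `≤ 3` is comb-positive
  at EVERY order** (in particular Sahi's `E_n ≥ 0`, `sahiE_ind_nonneg_of_core_le_three`).  Examples: union sunflowers `(x_c ∨ P_j)_j` and every family whose members are monotone
  combinations of `≤ 3` common coordinates with arbitrary member-private increasing events.
HONEST FRAMING: nothing here asserts (M⁺-k) or `C_k` for `k ≥ 3` in general. [this work]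
-/

noncomputable section

open scoped Classical

namespace Summit.CriticalPhenomena.PercolationContinuityZ3.Theorems

open Finset Function
open Literature.Combinatorics.Sahi2008
open Literature.Probability.LatticeModels.Kahn2022 (Affects)
open Literature.Probability.Percolation (DeterminedBy)
open Literature.Probability.Percolation.DecisionTree (ind)
open SahiComb SahiCombPrivate SahiCombCore SahiWidthCollapse

namespace SahiCombCore

/-! ### Width of `2^κ`, `|κ| ≤ 3`: no four pairwise incomparable subsets -/

/-- `C(c, ⌊c/2⌋) + 1 ≤ 4` for `c ≤ 3`. [folklore] -/
theorem choose_half_succ_le_four {c : ℕ} (hc : c ≤ 3) : c.choose (c / 2) + 1 ≤ 4 := by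
  interval_cases c <;> decide

/-- Among four subsets of a set with at most three elements two are comparable (Sperner). [folklore] -/
theorem exists_le_of_card_le_three {κ : Type} [Fintype κ] (hκ : Fintype.card κ ≤ 3) (x : Fin 4 → Set κ) :
    ∃ i j, i ≠ j ∧ x i ≤ x j := by
  have hm : (Fintype.card κ).choose (Fintype.card κ / 2) + 1 ≤ 4 := choose_half_succ_le_four hκ
  obtain ⟨i, j, hij, hle⟩ := finset_width_le_choose (β := κ) (fun l => (x (Fin.castLE hm l)).toFinset)
  refine ⟨Fin.castLE hm i, Fin.castLE hm j, fun h => hij (Fin.castLE_injective hm h), ?_⟩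
  intro y hy
  simpa using hle (by simpa using hy)

/-- **Every family of increasing events of a cube with at most three coordinates is fourwise meet-absorbing** (among any four members one contains the
intersection of the other three). [this work] -/
theorem cardwiseMeetAbsorbing_three_of_card_le_three {κ : Type} [Fintype κ] (hκ : Fintype.card κ ≤ 3) {n : ℕ} (W : Fin n → Set (Set κ))
    (hW : ∀ j, IsUpperSet (W j)) : CardwiseMeetAbsorbing 3 W := by
  intro e
  obtain ⟨m, hm⟩ := exists_absorbing_of_width (α := Set κ) (w := 3) (exists_le_of_card_le_three hκ)
    (fun a => (W (e a)).toFinset) (fun a => by simpa using hW (e a))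
  refine ⟨m, fun ω hω => ?_⟩
  have hω' : ∀ j, j ≠ m → ω ∈ (W (e j)).toFinset := fun j hj => by
    obtain ⟨b, hb⟩ := Fin.exists_succAbove_eq hj
    have := Set.mem_iInter.1 hω b
    rw [hb] at this
    simpa using this
  simpa using hm ω hω'

/-- **(M⁺-n) for EVERY `n` on cubes with at most three coordinates** (hierarchy lifting from the kernel `C₃` certificate; standard axioms). [this work] -/
theorem combPos_sahiE_ind_fam_of_card_le_three {κ : Type} [Fintype κ] (hκ : Fintype.card κ ≤ 3) {n : ℕ} (W : Fin n → Set (Set κ))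
    (hW : ∀ j, IsUpperSet (W j)) : CombPos (fun _ : κ => n) (fun p => sahiE (bernoulliWeight p) n (fun j => ind (W j))) :=
  combPos_sahiE_ind_of_fourwise W hW (cardwiseMeetAbsorbing_three_of_card_le_three hκ W hW)
    fun e => combPos_sahiE_three_fam_of_card_le_three hκ (fun l => W (e l)) fun _ => hW _

/-! ### Families with a core of at most three coordinates, every order -/

variable {ι : Type} [Fintype ι]

/-- **COMB POSITIVITY AT EVERY ORDER FOR FAMILIES WITH A CORE OF AT MOST THREE COORDINATES.**  Let `U_0,…,U_n` be increasing events of a finite cube and `S` a set of at most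
three coordinates such that every coordinate outside `S` affects at most one `U_j`.  Then `p ↦ E_{n+1}(μ_p; 1_U)` is a nonnegative combination of the degree-`(n+1)` tensor-Bernstein
basis. [this work] -/
theorem combPos_sahiE_ind_of_core_le_three (S : Finset ι) (hS3 : S.card ≤ 3) {n : ℕ} (U : Fin (n + 1) → Set (Set ι)) (hU : ∀ j, IsUpperSet (U j))
    (hpriv : ∀ e, e ∉ S → ∀ j j', Affects (U j) e → Affects (U j') e → j = j') :
    CombPos (fun _ : ι => n + 1) (fun p => sahiE (bernoulliWeight p) (n + 1) (fun j => ind (U j))) :=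
  combPos_sahiE_ind_of_core' S (fun V hVu hVd => combPos_of_determinedBy_of_cube S
    (fun W hW => combPos_sahiE_ind_fam_of_card_le_three (by rw [Fintype.card_coe]; exact hS3) W hW) V hVu hVd) U hU hpriv

/-- Law-level shadow: Sahi's `E_{n+1}(μ_p) ≥ 0`, every `n`, for families with a core of at most three coordinates (standard axioms). [this work] -/
theorem sahiE_ind_nonneg_of_core_le_three (p : ι → unitInterval) (S : Finset ι) (hS3 : S.card ≤ 3) {n : ℕ} (U : Fin (n + 1) → Set (Set ι))
    (hU : ∀ j, IsUpperSet (U j)) (hpriv : ∀ e, e ∉ S → ∀ j j', Affects (U j) e → Affects (U j') e → j = j') :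
    0 ≤ sahiE (bernoulliWeight p) (n + 1) (fun j => ind (U j)) :=
  (combPos_sahiE_ind_of_core_le_three S hS3 U hU hpriv).nonneg p

end SahiCombCore

end Summit.CriticalPhenomena.PercolationContinuityZ3.Theorems

end
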